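import Summits.BirchSwinnertonDyer.BirchSwinnertonDyer.Theorems.ResidualThetaTransportAtTwoThetaLayerLambdaCongruenceAtTwoCuspSpanArtinTools

/-!
# Route `ResidualThetaTransportAtTwo`, crux Kan⁺ `ThetaLayerLambdaCongruenceAtTwo` (stmt-BirchSwinnertonDyer-20688), node (G′)_N:
# the ARITHMETIC of the Artin lane — under Artin's conjecture for the base `2` in progressions, every column `(a, c)` with `N ∣ c`,
# `a ≡ 1 (mod N)`, `gcd(a, c) = 1` reaches, by the parabolic moves `a ↦ a + i c`, `c ↦ c + t N a`, a column killed by a `4^k`-class: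
# `(c₁ + t N x) ∣ x·4^k − 1`

Cell `bsd-wall`, width seat `bsd-wall-rtt-p3-w4` (g0). THEOREMS ONLY (pure arithmetic; no `def`, no `sorry`); `--supports stmt-BirchSwinnertonDyer-20688`;
BSD is not proved by this. Sequel of `…CuspSpanArtinTools` (§§1–4 there). This is the line-by-line version of lead `bsd-wall-rtt-p3` g9's sketch
`Cruxes/ThetaLayerLambdaCongruenceAtTwo/Lines/birth-generation.md` §4.2, with two corrections: (i) the witness is sought in the PARABOLIC ORBIT of
the column (the literal per-`γ` statement (W_N) of `…CuspSpanConjugation` is unsatisfiable at `N = 7`, e.g. for `γ = (29 2; 14 1)`: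
`(29/|2+29t|) = (±2/29) = −1`); (ii) no Legendre condition on `γ` survives — after moving to `|x| ≡ 3 (mod 4)` the two signs
`q ≡ ±c' (mod |x|)` have opposite symbols `(x/q)`, so one of them is good for EVERY column.

RECIPE (`exists_column_kill`). `N` odd, `n = ord_N(4)`, `M` = odd part of `n`. (1) `a₁ = a + i₀c` odd; (2) `c₁ = c + t₀Na₁` with `4 ∣ c₁ ≠ 0`;
(3) `x ≡ a₁ (mod c₁)`, prime to `c₁M`, `|x| ≡ 3 (mod 4)` (unit lifting + sign); (4) `s = −sign(x)·(c₁'/|x|)`, `c₁ = Nc₁'`;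
(5) an Artin prime `q ≡ s c₁' (mod |x|)`, `q ≡ 3 (mod 8)`, `q ≡ 2 (mod M)`, `q > N`, `2` a primitive root; (6) `(x/q) = 1` ⟹ `x ≡ 4^v`;
`gcd(ord_q 4, n) = 1` ⟹ `k ≥ 1` with `n ∣ k`, `4^{k+v} ≡ 1 (mod q)`; (7) `Nq ∣ x4^k − 1` and `c₁ + tNx = ±Nq` for `t = (±q − c₁')/x`.

* `exists_add_mul_odd`, `exists_add_mul_four_dvd` — the pre-moves (1), (2);
* `exists_column_kill` — the assembled arithmetic statement consumed by `…CuspSpanArtin` (the hypothesis is the TEXT of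
  `ArtinPrimitiveRootTwoAP` of `…ArtinDefs`, spelled out, so that this file depends on no definition).

References: [Moree2012ArtinSurvey] Thms. 1–2; [Lenstra1977Artin] Thm. 8.3.
-/

set_option autoImplicit false
set_option linter.dupNamespace false

open NumberTheorySymbols

namespace Summit.BirchSwinnertonDyer.BirchSwinnertonDyer.Theorems.SignedMuAtTwo

namespace CuspSpanArtin

/-! ## §5. The assembled arithmetic statement -/

/-- Parity pre-move: `a + i₀ c` is odd for some `i₀ ∈ {0, 1}` (`gcd(a, c) = 1`). [folklore] -/
theorem exists_add_mul_odd {a c : ℤ} (hcop : IsCoprime a c) : ∃ i₀ : ℤ, ¬ (2 : ℤ) ∣ a + i₀ * c := by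
  by_cases ha : (2 : ℤ) ∣ a
  · refine ⟨1, fun h ↦ ?_⟩
    have h2c : (2 : ℤ) ∣ c := by have := dvd_sub h ha; simpa using this
    have h1 := Int.isCoprime_iff_gcd_eq_one.mp hcop
    have h2 : (2 : ℤ) ∣ (Int.gcd a c : ℤ) := Int.dvd_coe_gcd ha h2c
    rw [h1] at h2
    norm_num at h2
  · exact ⟨0, by simpa using ha⟩

/-- `4`-divisibility pre-move: for `a₁` and `N` odd there is `t₀` with `4 ∣ c + t₀ N a₁ ≠ 0` (`y = N a₁` odd, `y² ≡ 1 (mod 8)`,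
`t₀ = −c y` or `−c y + 4`). [folklore] -/
theorem exists_add_mul_four_dvd {a₁ c : ℤ} {N : ℕ} (hN : N % 2 = 1) (ha₁ : ¬ (2 : ℤ) ∣ a₁) :
    ∃ t₀ : ℤ, (4 : ℤ) ∣ c + t₀ * N * a₁ ∧ c + t₀ * N * a₁ ≠ 0 := by
  set y : ℤ := (N : ℤ) * a₁ with hy
  have hyodd : ¬ (2 : ℤ) ∣ y := by
    rw [hy]
    intro h
    rcases Int.prime_two.dvd_mul.mp h with h | h
    · norm_cast at h
      omega
    · exact ha₁ h
  have hy4 : (4 : ℤ) ∣ 1 - y * y := by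
    have h' : y % 4 = 1 ∨ y % 4 = 3 := by omega
    have : (1 - y * y) % 4 = 0 := by
      rcases h' with h | h <;> rw [Int.sub_emod, Int.mul_emod, h] <;> norm_num
    exact Int.dvd_of_emod_eq_zero this
  by_cases h0 : c + (-c * y) * N * a₁ = 0
  · refine ⟨-c * y + 4, ?_, ?_⟩
    · rw [show c + (-c * y + 4) * N * a₁ = (c + (-c * y) * N * a₁) + 4 * (N * a₁) by ring, h0, zero_add]
      exact dvd_mul_right 4 _
    · rw [show c + (-c * y + 4) * N * a₁ = (c + (-c * y) * N * a₁) + 4 * y by rw [hy]; ring, h0, zero_add]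
      intro h
      have : y = 0 := by omega
      exact hyodd ⟨0, by rw [this]; ring⟩
  · refine ⟨-c * y, ?_, h0⟩
    rw [show c + (-c * y) * N * a₁ = c * (1 - y * y) by rw [hy]; ring]
    exact hy4.mul_left c

/-- **The arithmetic of the Artin lane (orbit form of the conjugation criterion, discharged).** Assume Artin's conjecture for the
base `2` in the progressions `r mod m`, `8 ∣ m`, `r ≡ 3 (mod 8)` (the text of `ArtinPrimitiveRootTwoAP`, spelled out). Let `N` be odd and
`(a, c)` a column with `N ∣ c`, `a ≡ 1 (mod N)`, `gcd(a, c) = 1` (the first column of an element of `Γ₁(N)`). Then after the parabolic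
pre-moves `a₁ = a + i₀ c`, `c₁ = c + t₀ N a₁`, `x = a₁ + i c₁` there are `t` and `k ≥ 1` with `(c₁ + t N x) ∣ x·4^k − 1`
(in fact `c₁ + t N x = ±N q` for an Artin prime `q ≡ 3 (mod 8)` with `(x/q) = +1` and `gcd(ord_q 4, ord_N 4) = 1`).
[cite: Moree2012ArtinSurvey, Thm. 1 (Lenstra) and Thm. 2] -/
theorem exists_column_kill
    (hA : ∀ m r : ℕ, 8 ∣ m → r % 8 = 3 → Nat.Coprime r m →
      ∀ B : ℕ, ∃ q : ℕ, B < q ∧ q.Prime ∧ q % m = r % m ∧ orderOf (2 : ZMod q) = q - 1)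
    {N : ℕ} (hN : N % 2 = 1) {a c : ℤ} (hNc : (N : ℤ) ∣ c) (ha : (N : ℤ) ∣ a - 1) (hcop : IsCoprime a c) :
    ∃ (i₀ t₀ i t : ℤ) (k : ℕ), 1 ≤ k ∧
      (c + t₀ * N * (a + i₀ * c) + t * N * (a + i₀ * c + i * (c + t₀ * N * (a + i₀ * c)))) ∣
        ((a + i₀ * c + i * (c + t₀ * N * (a + i₀ * c))) * 4 ^ k - 1) := by
  have hN0 : N ≠ 0 := by omega
  haveI : NeZero N := ⟨hN0⟩
  -- the order `n` of `4` mod `N` and its odd part `M`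
  have h4N : Nat.Coprime 4 N := by
    have h2N : Nat.Coprime 2 N := (Nat.Prime.coprime_iff_not_dvd Nat.prime_two).mpr (by omega)
    simpa using h2N.pow_left 2
  set u : (ZMod N)ˣ := ZMod.unitOfCoprime 4 h4N with hu
  set n := orderOf u with hn_def
  have hn : 0 < n := orderOf_pos u
  have h4pow : ∀ k : ℕ, n ∣ k → (4 : ZMod N) ^ k = 1 := fun k hk ↦ by
    have h1 : (u : ZMod N) = 4 := by rw [hu, ZMod.coe_unitOfCoprime]; norm_num
    rw [← h1, ← Units.val_pow_eq_pow_val, orderOf_dvd_iff_pow_eq_one.mp hk, Units.val_one]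
  set M := n / 2 ^ n.factorization 2 with hM_def
  have hM2 : ¬ 2 ∣ M := Nat.not_dvd_ordCompl Nat.prime_two hn.ne'
  have hM_pos : 0 < M := Nat.ordCompl_pos 2 hn.ne'
  have hnM : 2 ^ n.factorization 2 * M = n := Nat.ordProj_mul_ordCompl_eq_self n 2
  have hpM : ∀ p : ℕ, p.Prime → p ∣ n → p ≠ 2 → p ∣ M := fun p pp hpn hp2 ↦ by
    have hco : Nat.Coprime p (2 ^ n.factorization 2) :=
      ((Nat.coprime_primes pp Nat.prime_two).mpr hp2).pow_right _
    rw [← hnM] at hpn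
    exact hco.dvd_of_dvd_mul_left hpn
  -- pre-moves
  obtain ⟨i₀, ha₁odd⟩ := exists_add_mul_odd hcop
  set a₁ := a + i₀ * c with ha₁
  have ha₁cop : IsCoprime a₁ c := by rw [ha₁]; exact hcop.add_mul_right_left i₀
  have hNa₁ : (N : ℤ) ∣ a₁ - 1 := by
    rw [ha₁, show a + i₀ * c - 1 = (a - 1) + i₀ * c by ring]
    exact dvd_add ha (hNc.mul_left i₀)
  obtain ⟨t₀, h4c₁, hc₁0⟩ := exists_add_mul_four_dvd (c := c) hN ha₁odd
  set c₁ := c + t₀ * N * a₁ with hc₁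
  have hc₁cop : IsCoprime a₁ c₁ := by
    rw [hc₁, show c + t₀ * N * a₁ = c + a₁ * (t₀ * N) by ring]
    exact ha₁cop.add_mul_left_right _
  have hNc₁ : (N : ℤ) ∣ c₁ := by rw [hc₁]; exact dvd_add hNc ⟨t₀ * a₁, by ring⟩
  -- the representative
  obtain ⟨x, hxa, hxcop, hx3⟩ := exists_rep hM_pos hc₁0 h4c₁ hc₁cop
  obtain ⟨i, hi⟩ := hxa
  have hx_eq : x = a₁ + i * c₁ := by linear_combination hi
  set b := x.natAbs with hb
  have hb2 : b % 2 = 1 := by omega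
  have hxc₁ : IsCoprime x c₁ := hxcop.of_mul_right_left
  have hxM : IsCoprime x (M : ℤ) := hxcop.of_mul_right_right
  have hbM : Nat.Coprime b M := by
    have := Int.isCoprime_iff_gcd_eq_one.mp hxM
    simpa [Int.gcd, b] using this
  obtain ⟨c₁', hc₁'⟩ := hNc₁
  have hgcd : Int.gcd c₁' x = 1 := by
    have h1 : IsCoprime c₁' x := (hxc₁.of_isCoprime_of_dvd_right ⟨(N : ℤ), by rw [hc₁']; ring⟩).symm
    exact Int.isCoprime_iff_gcd_eq_one.mp h1
  have hx1 : (N : ℤ) ∣ x - 1 := by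
    rw [show x - 1 = (x - a₁) + (a₁ - 1) by ring]
    exact dvd_add ⟨c₁' * i, by rw [hi, hc₁']; ring⟩ hNa₁
  -- the sign `s` and the progression
  have hx0 : x ≠ 0 := by
    intro h
    rw [h, Int.natAbs_zero] at hb
    rw [hb] at hx3
    norm_num at hx3
  have hσ : x.sign = 1 ∨ x.sign = -1 := by
    rcases lt_or_gt_of_ne hx0 with h | h
    · exact Or.inr (Int.sign_eq_neg_one_of_neg h)
    · exact Or.inl (Int.sign_eq_one_of_pos h)
  have hJc : J(c₁' | b) = 1 ∨ J(c₁' | b) = -1 := jacobiSym.eq_one_or_neg_one (by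
    have : Int.gcd c₁' (b : ℤ) = Int.gcd c₁' x := by simp [Int.gcd, b, Int.natAbs_abs]
    rw [this]; exact hgcd)
  set s : ℤ := -x.sign * J(c₁' | b) with hs
  have hs1 : s = 1 ∨ s = -1 := by
    rcases hσ with h | h <;> rcases hJc with h' | h' <;> simp [hs, h, h']
  have hsu : IsUnit s := by
    rcases hs1 with h | h <;> rw [h]
    · exact isUnit_one
    · exact isUnit_one.neg
  have hb0 : (b : ℤ) ≠ 0 := by exact_mod_cast Int.natAbs_ne_zero.mpr hx0
  set r₁ : ℕ := ((s * c₁') % (b : ℤ)).toNat with hr₁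
  have hr₁_eq : (r₁ : ℤ) = (s * c₁') % (b : ℤ) := Int.toNat_of_nonneg (Int.emod_nonneg _ hb0)
  have hr₁cop : Nat.Coprime r₁ b := by
    have h1 : IsCoprime (s * c₁') x := by
      refine IsCoprime.mul_left ?_ (Int.isCoprime_iff_gcd_eq_one.mpr hgcd)
      rcases hs1 with h | h <;> rw [h]
      · exact isCoprime_one_left
      · exact isCoprime_one_left.neg_left
    have h3 : IsCoprime (s * c₁') (b : ℤ) := by
      rcases Int.natAbs_eq x with h | h
      · rw [hb, ← h]; exact h1
      · rw [hb, show ((x.natAbs : ℕ) : ℤ) = -x by omega]; exact h1.neg_right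
    have h2 : IsCoprime ((s * c₁') % (b : ℤ)) (b : ℤ) := by
      rw [Int.emod_def, show s * c₁' - b * (s * c₁' / b) = s * c₁' + b * (-(s * c₁' / b)) by ring]
      exact h3.add_mul_left_left _
    have h4 := Int.isCoprime_iff_gcd_eq_one.mp h2
    rw [← hr₁_eq, Int.gcd_natCast_natCast] at h4
    exact h4
  obtain ⟨m, r, h8m, hr8, hrm, hprog⟩ := exists_progression b M r₁ hb2 (by omega) hbM hr₁cop
  -- the Artin prime
  obtain ⟨q, hNq_lt, hqP, hqm, h2q⟩ := hA m r h8m hr8 hrm N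
  haveI : Fact q.Prime := ⟨hqP⟩
  obtain ⟨hqb, hq8, hqM⟩ := hprog q hqm
  have hq4 : q % 4 = 3 := by omega
  -- `(x/q) = +1`, `x ≡ 4^v (mod q)`, the exponent `k`
  have hmod : (q : ℤ) % (b : ℤ) = (s * c₁') % (b : ℤ) := by
    rw [← Int.natCast_mod, hqb, Int.natCast_mod, hr₁_eq, Int.emod_emod_of_dvd _ dvd_rfl]
  have hJ : J(x | q) = 1 := jacobiSym_eq_one_of_emod_eq hq4 hx3 hgcd (by rw [← hb, ← hs]; exact hmod)
  obtain ⟨v, hv⟩ := exists_four_pow_eq h2q hJ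
  obtain ⟨ho, hco⟩ := coprime_orderOf_four hq8 (n := n) (fun p pp hpn hp2 ↦ by
    have hpM' := hpM p pp hpn hp2
    rw [← Nat.mod_mod_of_dvd q hpM', hqM, Nat.mod_mod_of_dvd 2 hpM'])
  obtain ⟨k, hk1, hnk, hk4⟩ := exists_exponent hn ho hco v
  -- divisibility by `q` and by `N`
  have hqdvd : (q : ℤ) ∣ x * 4 ^ k - 1 := by
    rw [← ZMod.intCast_zmod_eq_zero_iff_dvd]
    push_cast
    rw [← hv, ← pow_add, add_comm, hk4, sub_self]
  have hNdvd : (N : ℤ) ∣ x * 4 ^ k - 1 := by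
    rw [← ZMod.intCast_zmod_eq_zero_iff_dvd]
    push_cast
    have hx1' : ((x : ℤ) : ZMod N) = ((1 : ℤ) : ZMod N) :=
      (ZMod.intCast_eq_intCast_iff_dvd_sub x 1 N).mpr (by
        rw [show (1 : ℤ) - x = -(x - 1) by ring]; exact hx1.neg_right)
    rw [Int.cast_one] at hx1'
    rw [hx1', h4pow k hnk]
    ring
  have hNq : IsCoprime (N : ℤ) (q : ℤ) := by
    rw [Int.isCoprime_iff_gcd_eq_one, Int.gcd_natCast_natCast]
    refine Nat.coprime_comm.mp ((Nat.Prime.coprime_iff_not_dvd hqP).mpr fun h ↦ ?_)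
    have := Nat.le_of_dvd (by omega) h
    omega
  have hNqdvd : ((N : ℤ) * q) ∣ x * 4 ^ k - 1 := hNq.mul_dvd hNdvd hqdvd
  -- the parameter `t`: `c₁ + t N x = s N q`
  have hbx : (b : ℤ) ∣ s * c₁' - q := Int.ModEq.dvd hmod
  obtain ⟨w, hw⟩ := Int.natAbs_dvd.mp hbx
  have hss : s * s = 1 := by rcases hs1 with h | h <;> simp [h]
  have key : c₁ + (-s * w) * N * x = s * ((N : ℤ) * q) := by
    have hq' : (q : ℤ) = s * c₁' - x * w := by linear_combination -hw
    rw [hq', hc₁']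
    linear_combination (-(N : ℤ) * c₁') * hss
  refine ⟨i₀, t₀, i, -s * w, k, hk1, ?_⟩
  rw [← hx_eq, key]
  exact hsu.mul_left_dvd.mpr hNqdvd

end CuspSpanArtin

end Summit.BirchSwinnertonDyer.BirchSwinnertonDyer.Theorems.SignedMuAtTwo
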